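import Summits.Ventures.HodgeRepro2.T6N41PlaceHyp

/-!
# T6N41PlaceMain — the unramified identity `hunr` from the placement datum (Tier 6, M2; proof lane; owner t6-p4)

`N41_placement_of_satake`: for the N4.1 datum `D` and a placement datum `Pl` over it, the two displays of
`T6N41PlaceHyp` (Lapid–Rallis §7 / §10: `L(s, π_v × χ_{V,v}) = L(s, BC(π_v) ⊗ χ_{V,v})` off `S`; Bump (5.22): the
local L-function of a nonramified principal series of `GL(2)` in its Satake parameters) and the Satake identity
`Pl.Satake` (the placement (P7) in local words — the NARROWED residual of this layer) give the binder `hunr` of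
`N41_mainE` / `N4_main`:

  `∀ v ∉ D.S, ∀ s, D.Lv v s = D.g₁ v s * D.g₂ v s`.

Proof: at `v ∉ S`, `D.Lv v = Pl.LGLv v` (LR) `= ∏_{𝔓 | v} LGL 𝔓 (BCχ 𝔓)` (the datum's reading of the `GL₂(E_v)`
factor) `= ∏_{𝔓 | v} (1 − α_𝔓 N𝔓^{−s})⁻¹ (1 − β_𝔓 N𝔓^{−s})⁻¹` (`BCχ_ps` + Bump) `= ∏_{𝔓 | v} (1 − η₁′(𝔓)
N𝔓^{−s})⁻¹ (1 − η₂′(𝔓) N𝔓^{−s})⁻¹` (`Satake`, the two factors commute) `= D.g₁ v s * D.g₂ v s` (`g₁_eq`, `g₂_eq`,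
`Finset.prod_mul_distrib`).  `#print axioms` = {propext, Classical.choice, Quot.sound}.

§8(d): uses an L-value-free non-vanishing device: NO.
-/

namespace Summit.Ventures.HodgeRepro2.T6
namespace N41Place

open PlacementDatum

/-- The product of Bump's two factors at `𝔓` for the Satake pair `(α, β)` equals the product for the pair
`(η₁, η₂)` whenever the two pairs agree as unordered pairs. -/
theorem eulerFactor_mul_of_satake {ι : Type*} {D : DoublingLDatum ι} (Pl : PlacementDatum D) (𝔓 : Pl.κ)
    (h : (Pl.α 𝔓 = Pl.η₁ 𝔓 ∧ Pl.β 𝔓 = Pl.η₂ 𝔓) ∨ (Pl.α 𝔓 = Pl.η₂ 𝔓 ∧ Pl.β 𝔓 = Pl.η₁ 𝔓)) (s : ℂ) :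
    Pl.eulerFactor 𝔓 (Pl.α 𝔓) s * Pl.eulerFactor 𝔓 (Pl.β 𝔓) s =
      Pl.eulerFactor 𝔓 (Pl.η₁ 𝔓) s * Pl.eulerFactor 𝔓 (Pl.η₂ 𝔓) s := by
  rcases h with ⟨h₁, h₂⟩ | ⟨h₁, h₂⟩
  · rw [h₁, h₂]
  · rw [h₁, h₂, mul_comm]

/-- **The unramified identity (P3)+(P7) of N4.1 from the placement datum.** For every `v ∉ S` and every `s`,
`L(s, π_v × χ_{V,v}) = L_v(s, η₁′) L_v(s, η₂′)` — the `hunr` binder of `N41_mainE` — from the displays LR §7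
(`hLR7`) and Bump (5.22) (`hB`) and the Satake identity `hS : Pl.Satake` (the residual of this layer). -/
theorem N41_placement_of_satake {ι : Type*} (D : DoublingLDatum ι) (Pl : PlacementDatum D)
    (hLR7 : Hyp.LapidRallis2005_Sec7_Unramified D Pl) (hB : Hyp.Bump1997_5_22 Pl)
    -- [residual: AD (narrowed); the Satake identity of (P7) — Harris II (2.2.5)(b) + Rogawski §11.4 at the
    -- inert places, Mínguez Thm 1(2) + the split dictionary (A″κ) (GR91 §3 / Rao 1993) at the split places]
    (hS : Pl.Satake) :
    ∀ v ∉ D.S, ∀ s : ℂ, D.Lv v s = D.g₁ v s * D.g₂ v s := by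
  intro v hv s
  have hfib : ∀ 𝔓 ∈ Pl.fiber v, Pl.b 𝔓 ∉ D.S := by
    intro 𝔓 h𝔓
    rw [Pl.mem_fiber.1 h𝔓]
    exact hv
  rw [hLR7 v hv, Pl.LGLv_eq v, Pl.g₁_eq v hv, Pl.g₂_eq v hv]
  simp only
  rw [← Finset.prod_mul_distrib]
  refine Finset.prod_congr rfl fun 𝔓 h𝔓 => ?_
  rw [Pl.BCχ_ps 𝔓 (hfib 𝔓 h𝔓), hB 𝔓 (Pl.α 𝔓) (Pl.β 𝔓)]
  exact eulerFactor_mul_of_satake Pl 𝔓 (hS 𝔓 (hfib 𝔓 h𝔓)) s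

end N41Place
end Summit.Ventures.HodgeRepro2.T6
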